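import Summits.AtomisticToContinuum.HydrodynamicLimit.Theorems.JaynesSqueezeSqueezeToBlockGibbs
import Summits.AtomisticToContinuum.HydrodynamicLimit.Theorems.JaynesSqueezeHardSphereLDA
import Summits.AtomisticToContinuum.HydrodynamicLimit.Theorems.StiffCollisionalRelaxationAprioriBoundsFibreBracketVanishA
import HarnessLib

/-!
# Rate-free statics of the line `fibre-deficit-transfer` (crux `AprioriBounds`, stmt-AtomisticToContinuum-14827),
part B: the thermodynamic limit of the fine-grained entropy of the initial local Gibbs law

Support file (`--supports stmt-AtomisticToContinuum-14827`) of the lead prover of the line (stub `stub_bracketVanish` of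
skeleton r4, worker file B).  The Gibbs entropy of the local Gibbs law of `N + 1` spheres is `S(μ₀) = log Z_N(a₀) −
(N+1)·E⟨emp, log prof₀⟩`; this file computes the limit of `(N+1)⁻¹ S(μ₀)` under the crux prefix (registered sub-goal
`tendsto_entropy_timeZero`, stated in the tree's vocabulary `(N+1)⁻¹ log Z_N(a₀) − E⟨emp, log prof₀⟩`):

  `(N+1)⁻¹ log Z_N(a₀) − E_{μ₀}⟨emp, log prof₀⟩ → ∫ ρ(0)[(3/2)log θ(0) − log ρ(0) − f_ex(ρ(0)σ³)] + 3/2 + (3/2) log 2π`,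

for every field triple `(ρ, u, θ)` with continuous time-`0` slices tied at `t = 0` to the local Gibbs laws (`TendstoHydroFieldsAt … 0`).
Ingredients (all LANDED): `HardSphereLDA` (A) writes `a₀ = e^c ρ_a e^{g_σ(ρ_a)}` with `∫ρ_a = 1`; (B) gives the local density
approximation of `log Z_N` and the law of large numbers of the MEAN empirical density at the activity `ρ_a e^{g_σ(ρ_a)}`;
`JaynesSqueezeSqueeze.tendsto_timeZero_term` assembles the limit in terms of `ρ_a`; the tree's LLN `localGibbs_lln_holds` + data pinning
`EntropyClockDock.data_eq_of_ties` + bounded convergence in probability (`tendsto_integral_of_tendsto_measure_gt`) + test functions determine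
a density (`ae_eq_of_forall_integral_mul_eq`) identify `ρ_a = ρ(0,·)` a.e. and `θ₀ = θ(0,·)` — the pattern of the landed
`JaynesSqueezeSqueeze.squeezeToBlockGibbs_proof`, step (iii).
-/

noncomputable section

open MeasureTheory Filter Set Topology
open scoped ENNReal

namespace Summit.AtomisticToContinuum.HydrodynamicLimit.Theorems.FibreDeficitTransfer

open Literature.MathematicalPhysics.KineticTheory Literature.Analysis.FluidPDE
open Literature.Analysis.FunctionSpaces
open MacroClosureLine.StubLedger JaynesSqueezeSqueeze

/-- **The thermodynamic limit of the fine-grained entropy of the initial local Gibbs law** (registered sub-goal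
`tendsto_entropy_timeZero`).  For continuous positive profiles there is `σ₁ > 0` (`≤ 1/2`) such that for `0 < σ < σ₁`, every field
triple with continuous time-`0` slices tied at `t = 0` to the local Gibbs laws through a flow family satisfies
`(N+1)⁻¹ log Z_N(a₀) − E_{μ₀}⟨emp, log prof₀⟩ → 𝒮[ρ(0), θ(0)] + 3/2 + (3/2) log 2π`,
`𝒮[ρ, θ] = ∫ ρ((3/2)log θ − log ρ − f_ex(ρσ³))`. -/
theorem tendsto_entropy_timeZero : ∀ (a₀ θ₀ : T3 → ℝ) (u₀ : T3 → V3), Continuous a₀ → Continuous θ₀ → Continuous u₀ → (∀ x, 0 < a₀ x) → (∀ x, 0 < θ₀ x) → ∃ σ₁ : ℝ, 0 < σ₁ ∧ σ₁ ≤ 1 / 2 ∧ ∀ σ : ℝ, 0 < σ → σ < σ₁ → ∀ (ρ θ : ℝ → T3 → ℝ) (u : ℝ → T3 → V3), Continuous (ρ 0) → Continuous (θ 0) → Continuous (u 0) → ∀ Φ : (N : ℕ) → HardSphereFlow (Torus.geometry (Fin 3)) (hsDiameter σ N) (N + 1), TendstoHydroFieldsAt (fun N => localGibbsLaw σ a₀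 u₀ θ₀ N (Φ N)) Φ ρ u θ 0 → Tendsto (fun N : ℕ => ((N : ℝ) + 1)⁻¹ * Real.log (canonicalPartition (Torus.geometry (Fin 3)) (hsDiameter σ N) (N + 1) (localGibbsProfile a₀ u₀ θ₀)) - ∫ z, (∫ y, Real.log (localGibbsProfile a₀ u₀ θ₀ y) ∂(empiricalMeasure z)) ∂(localGibbsLaw σ a₀ u₀ θ₀ N (Φ N))) atTop (𝓝 ((∫ x, ρ 0 x * (3 / 2 * Real.log (θ 0 x) - Real.log (ρ 0 x) - hsExcessFreeEnergy (ρ 0 x * σ ^ 3))) + 3 / 2 + 3 / 2 * Real.log (2 * Real.pi))) := by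
  intro a₀ θ₀ u₀ ha hθ hu ha0 hθ0
  classical
  -- statics
  obtain ⟨η₁, hη₁, hLDAσ⟩ := hardSphereLDA_proof Theses.JaynesSqueeze.HsEosLowDensity_holds
  obtain ⟨η₀, hη₀, F, hF, hEq, -, -, -⟩ := hsEosLowDensity_proof
  obtain ⟨hfc, hdfc⟩ := bv_eos_continuousOn hF hEq
  -- bounds on the data activity
  obtain ⟨Ma, -, hMa⟩ := exists_forall_abs_le_of_continuous ha
  obtain ⟨Mi, -, hMi⟩ := exists_forall_abs_le_of_continuous (ha.inv₀ fun x => (ha0 x).ne')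
  set Λ : ℝ := max (max Ma Mi) 1 with hΛ
  have hΛ1 : 1 ≤ Λ := le_max_right _ _
  have hΛpos : 0 < Λ := by linarith only [hΛ1]
  have haΛ : ∀ x, Λ⁻¹ ≤ a₀ x ∧ a₀ x ≤ Λ := by
    intro x
    constructor
    · rw [inv_le_comm₀ hΛpos (ha0 x)]
      calc (a₀ x)⁻¹ ≤ |(a₀ x)⁻¹| := le_abs_self _
        _ ≤ Mi := hMi x
        _ ≤ Λ := (le_max_right _ _).trans (le_max_left _ _)
    · calc a₀ x ≤ |a₀ x| := le_abs_self _
        _ ≤ Ma := hMa x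
        _ ≤ Λ := (le_max_left _ _).trans (le_max_left _ _)
  -- thresholds
  obtain ⟨σL, hσL, hlln'⟩ := localGibbs_lln_holds a₀ θ₀ u₀ ha hθ hu ha0 hθ0
  set rA : ℝ := min η₀ η₁ / (4 * Λ ^ 2) with hrA
  have hrA0 : 0 < rA := by positivity
  set σA : ℝ := rA ^ ((1 : ℝ) / 3) with hσA
  have hσA0 : 0 < σA := Real.rpow_pos_of_pos hrA0 _
  refine ⟨min (min σL σA) (1 / 2), by positivity, min_le_right _ _, ?_⟩
  intro σ hσ hσ0 ρ θ u hρ0c hθ0c hu0c Φ hLLN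
  have hσL' : σ < σL := hσ0.trans_le ((min_le_left _ _).trans (min_le_left _ _))
  have hσA' : σ < σA := hσ0.trans_le ((min_le_left _ _).trans (min_le_right _ _))
  have hσ2 : σ ≤ 1 / 2 := (hσ0.trans_le (min_le_right _ _)).le
  have hσ3 : σ ^ 3 < rA := pow_three_lt_of_lt_rpow_third hσ.le hrA0.le hσA'
  have hσ3pos : 0 < σ ^ 3 := pow_pos hσ 3
  have hΛσ : 2 * Λ ^ 2 * σ ^ 3 ≤ min η₀ η₁ / 2 := by
    have h1 : 2 * Λ ^ 2 * σ ^ 3 ≤ 2 * Λ ^ 2 * rA := mul_le_mul_of_nonneg_left hσ3.le (by positivity)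
    have h2 : 2 * Λ ^ 2 * rA = min η₀ η₁ / 2 := by rw [hrA]; field_simp; ring
    linarith only [h1, h2]
  have hΛσ₁ : 2 * Λ ^ 2 * σ ^ 3 ≤ η₁ :=
    hΛσ.trans ((div_le_self (le_min hη₀.le hη₁.le) (by norm_num)).trans (min_le_right _ _))
  have hΛσ₀ : 2 * Λ ^ 2 * σ ^ 3 < η₀ :=
    hΛσ.trans_lt ((div_lt_self (lt_min hη₀ hη₁) (by norm_num)).trans_le (min_le_left _ _))
  -- the equation-of-state functions at this `σ`
  set g : ℝ → ℝ := fun r => hsExcessFreeEnergy (r * σ ^ 3) + r * σ ^ 3 * deriv hsExcessFreeEnergy (r * σ ^ 3) with hg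
  set ψ : ℝ → ℝ := fun r => r * σ ^ 3 * deriv hsExcessFreeEnergy (r * σ ^ 3) with hψ
  have hgψ : ∀ r, g r = hsExcessFreeEnergy (r * σ ^ 3) + ψ r := fun r => rfl
  have hψr : ∀ r, r * σ ^ 3 * deriv hsExcessFreeEnergy (r * σ ^ 3) = ψ r := fun r => rfl
  have hgψr : ∀ r, hsExcessFreeEnergy (r * σ ^ 3) + ψ r = g r := fun r => rfl
  have hJ : ∀ r ∈ Ioo (0 : ℝ) (η₀ / σ ^ 3), r * σ ^ 3 ∈ Ioo 0 η₀ := fun r hr =>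
    ⟨mul_pos hr.1 hσ3pos, (lt_div_iff₀ hσ3pos).1 hr.2⟩
  have hlin : ContinuousOn (fun r : ℝ => r * σ ^ 3) (Ioo 0 (η₀ / σ ^ 3)) := continuousOn_id.mul continuousOn_const
  have hψcJ : ContinuousOn ψ (Ioo 0 (η₀ / σ ^ 3)) := hlin.mul (hdfc.comp hlin hJ)
  -- static data at time zero: `HardSphereLDA` (A) then (B)
  obtain ⟨hAσ, hBσ⟩ := hLDAσ σ hσ
  have hΛσ₁' : Λ ^ 2 * σ ^ 3 ≤ η₁ := by nlinarith only [hΛσ₁, hΛpos, hσ3pos]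
  obtain ⟨ρa, hρam, hρab, hρa1, c, hc⟩ := hAσ Λ hΛ1 hΛσ₁' a₀ ha.measurable haΛ
  simp only [hψr, hgψr] at hc
  have hcl : (0 : ℝ) < (2 * Λ ^ 2)⁻¹ := by positivity
  have hρaσ : ∀ x, (2 * Λ ^ 2)⁻¹ ≤ ρa x ∧ ρa x * σ ^ 3 ≤ η₁ := fun x =>
    ⟨(hρab x).1, (mul_le_mul_of_nonneg_right (hρab x).2 hσ3pos.le).trans hΛσ₁⟩
  obtain ⟨hZa, -, hmeana⟩ := hBσ _ hcl ρa hρam hρaσ hρa1 u₀ θ₀ hu.measurable hθ.measurable hθ0 Φ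
  simp only [hψr, hgψr] at hZa hmeana
  -- the law of large numbers and data pinning
  obtain ⟨ρ₀, hρ₀c, hρ₀p, hllnΦ⟩ := hlln' σ hσ hσL'
  obtain ⟨-, hlln0⟩ := hllnΦ Φ
  obtain ⟨hρ0, -, hθ0eq⟩ := EntropyClockDock.data_eq_of_ties hσ2 Φ ha hθ hu ha0 hθ0 hρ₀c hρ₀p hlln0 hρ0c hu0c hθ0c hLLN
  -- `ρa = ρ₀` almost everywhere: the mean empirical density converges to both
  have hP : ∀ N, IsProbabilityMeasure (localGibbsLaw σ a₀ u₀ θ₀ N (Φ N)) := fun N =>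
    isProbabilityMeasure_localGibbsLaw ha hθ hu ha0 hθ0 hσ2 N (Φ N)
  have hlaw : ∀ N, localGibbsLaw σ a₀ u₀ θ₀ N (Φ N) = localGibbsLaw σ (fun x => ρa x * Real.exp (g (ρa x))) u₀ θ₀ N (Φ N) := by
    intro N
    have e : a₀ = fun x => Real.exp c * (ρa x * Real.exp (g (ρa x))) := by funext x; rw [hc x]; ring
    rw [e]
    exact localGibbsLaw_const_mul (Φ N) _ θ₀ u₀ (Real.exp_pos c)
  have hρaρ₀ : ρa =ᵐ[volume] ρ₀ := by
    have hρaI : Integrable ρa := (integrable_const (2 * Λ ^ 2)).mono' hρam.aestronglyMeasurable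
      (Eventually.of_forall fun x => by
        rw [Real.norm_eq_abs, abs_of_nonneg (hcl.le.trans (hρab x).1)]; exact (hρab x).2)
    refine ae_eq_of_forall_integral_mul_eq hρaI (integrable_of_continuous_T3 hρ₀c) (fun x => hcl.le.trans (hρab x).1)
      (fun x => (hρ₀p x).le) fun χ hχ => ?_
    obtain ⟨C, hC0, hC⟩ := exists_forall_abs_le_of_continuous hχ
    have h1 : Tendsto (fun N : ℕ => ∫ z, empiricalDensityField z χ ∂(localGibbsLaw σ a₀ u₀ θ₀ N (Φ N))) atTop
        (𝓝 (∫ x, χ x * ρa x)) := by simp_rw [hlaw]; exact hmeana χ hχ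
    have hbd : |∫ x, χ x * ρ₀ x| ≤ C * ⨆ x, ρ₀ x := by
      obtain ⟨R, -, hR⟩ := exists_forall_abs_le_of_continuous hρ₀c
      have hsup : ∀ x, ρ₀ x ≤ ⨆ y, ρ₀ y := fun x =>
        le_ciSup ⟨R, by rintro _ ⟨y, rfl⟩; exact (le_abs_self _).trans (hR y)⟩ x
      calc |∫ x, χ x * ρ₀ x| ≤ ∫ x, |χ x * ρ₀ x| := abs_integral_le_integral_abs
        _ ≤ ∫ x, C * ⨆ y, ρ₀ y := by
            refine integral_mono (integrable_of_continuous_T3 (hχ.mul hρ₀c)).abs (integrable_const _) fun x => ?_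
            rw [abs_mul, abs_of_pos (hρ₀p x)]
            exact mul_le_mul (hC x) (hsup x) (hρ₀p x).le hC0
        _ = C * ⨆ y, ρ₀ y := by rw [integral_const, smul_eq_mul, probReal_univ, one_mul]
    have h2 : Tendsto (fun N : ℕ => ∫ z, empiricalDensityField z χ ∂(localGibbsLaw σ a₀ u₀ θ₀ N (Φ N))) atTop
        (𝓝 (∫ x, χ x * ρ₀ x)) := by
      refine tendsto_integral_of_tendsto_measure_gt (Eventually.of_forall hP)
        (X := fun N z => empiricalDensityField z χ) (fun N => ?_) (M := max C (C * ⨆ x, ρ₀ x))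
        (fun N z => (abs_empiricalDensityField_le z hC).trans (le_max_left _ _)) (hbd.trans (le_max_right _ _)) ?_
      · simp_rw [empiricalDensityField_eq_sum]
        exact measurable_const.mul (Finset.measurable_sum _ fun i _ => hχ.measurable.comp (measurable_pi_apply i).fst)
      · intro δ hδ
        have h := (hlln0 χ hχ δ hδ).1
        refine h.congr fun N => ?_
        exact EntropyClockDock.localGibbsLaw_setOf_flow_zero σ a₀ u₀ θ₀ N (Φ N)
          fun z => δ < |empiricalDensityField z χ - ∫ x, χ x * ρ₀ x|
    exact tendsto_nhds_unique h1 h2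
  -- the time-zero term of the tree (`tendsto_timeZero_term`): bounds of its one-body functions
  have hF_Icc : ContinuousOn F (Icc 0 (2 * Λ ^ 2 * σ ^ 3)) :=
    hF.continuousOn.mono fun η hη => ⟨by linarith [hη.1, hη₀], hη.2.trans_lt hΛσ₀⟩
  have hρaσI : ∀ x, ρa x * σ ^ 3 ∈ Icc 0 (2 * Λ ^ 2 * σ ^ 3) := fun x =>
    ⟨(mul_pos (hcl.trans_le (hρab x).1) hσ3pos).le, mul_le_mul_of_nonneg_right (hρab x).2 hσ3pos.le⟩
  have hρaσ0 : ∀ x, ρa x * σ ^ 3 ∈ Ico 0 η₀ := fun x => ⟨(hρaσI x).1, (hρaσI x).2.trans_lt hΛσ₀⟩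
  obtain ⟨Bf, hBf⟩ := (isCompact_Icc (a := (0 : ℝ)) (b := 2 * Λ ^ 2 * σ ^ 3)).exists_bound_of_continuousOn hF_Icc
  have hfm : Measurable fun x => hsExcessFreeEnergy (ρa x * σ ^ 3) := by
    have : (fun x => hsExcessFreeEnergy (ρa x * σ ^ 3)) = fun x => F (ρa x * σ ^ 3) := funext fun x => hEq (hρaσ0 x)
    rw [this]
    exact measurable_comp_of_continuousOn hF_Icc (hρam.mul_const _) hρaσI
  have hfb : ∀ x, |hsExcessFreeEnergy (ρa x * σ ^ 3)| ≤ Bf := fun x => by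
    rw [hEq (hρaσ0 x)]; simpa [Real.norm_eq_abs] using hBf _ (hρaσI x)
  have hρaJ : ∀ x, ρa x ∈ Icc (2 * Λ ^ 2)⁻¹ (2 * Λ ^ 2) := fun x => hρab x
  have hJsub : Icc (2 * Λ ^ 2)⁻¹ (2 * Λ ^ 2) ⊆ Ioo 0 (η₀ / σ ^ 3) := fun r hr =>
    ⟨hcl.trans_le hr.1, (lt_div_iff₀ hσ3pos).2 (lt_of_le_of_lt (mul_le_mul_of_nonneg_right hr.2 hσ3pos.le) hΛσ₀)⟩
  have hψcI : ContinuousOn ψ (Icc (2 * Λ ^ 2)⁻¹ (2 * Λ ^ 2)) := hψcJ.mono hJsub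
  obtain ⟨Bψ, hBψ⟩ := (isCompact_Icc (a := (2 * Λ ^ 2)⁻¹) (b := 2 * Λ ^ 2)).exists_bound_of_continuousOn hψcI
  have hψm : Measurable fun x => ψ (ρa x) := measurable_comp_of_continuousOn hψcI hρam hρaJ
  have hψb : ∀ x, |ψ (ρa x)| ≤ Bψ := fun x => by simpa [Real.norm_eq_abs] using hBψ _ (hρaJ x)
  have hTZ := tendsto_timeZero_term hσ2 ha hθ hu ha0 hθ0 Φ hρam hcl (fun x => hρab x) hρa1 g ψ hgψ hfm hfb hψm hψb hc
    hZa hmeana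
  -- identification of the thermodynamic entropy of the data
  have hS₀ : ∫ x, ρa x * (3 / 2 * Real.log (θ₀ x) - Real.log (ρa x) - hsExcessFreeEnergy (ρa x * σ ^ 3)) =
      ∫ x, ρ 0 x * (3 / 2 * Real.log (θ 0 x) - Real.log (ρ 0 x) - hsExcessFreeEnergy (ρ 0 x * σ ^ 3)) := by
    rw [hρ0, hθ0eq]
    refine integral_congr_ae ?_
    filter_upwards [hρaρ₀] with x hx
    rw [hx]
  rw [hS₀] at hTZ
  have h := hTZ.neg
  refine (h.congr fun N => ?_).trans ?_
  · ring
  · rw [show -(-(∫ x, ρ 0 x * (3 / 2 * Real.log (θ 0 x) - Real.log (ρ 0 x) - hsExcessFreeEnergy (ρ 0 x * σ ^ 3))) -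
        3 / 2 - 3 / 2 * Real.log (2 * Real.pi)) =
        (∫ x, ρ 0 x * (3 / 2 * Real.log (θ 0 x) - Real.log (ρ 0 x) - hsExcessFreeEnergy (ρ 0 x * σ ^ 3))) + 3 / 2 +
          3 / 2 * Real.log (2 * Real.pi) by ring]

end Summit.AtomisticToContinuum.HydrodynamicLimit.Theorems.FibreDeficitTransfer

end
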